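import Mathlib.Data.Int.ConditionallyCompleteOrder
import Literature.MathematicalPhysics.StatisticalMechanics.BarlowStackingHeights

/-!
# Crux `HcpLandscapeGap` (stmt-AtomisticToContinuum-12087), line `birth` — stub `stub_fibreDecomposition`

STUB RF of the skeleton `Cruxes/HcpLandscapeGap/Lines/birth.lean`: a ball window
`{x ∈ barlowStackingH a H s : dist x c ≤ L}` of a Barlow multilattice (in-layer spacing
`a ∈ [47/50, 1]`, heights `H` with spacings in `[39a/50, 17a/20]`) is cut into vertical FIBRE
INTERVALS — one site per layer over an integer interval of layers —, at most `25 (L+1)²` of them, up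
to leftover points at depth `< 5` below the boundary sphere.

Construction.  Write the letter of layer `k` as `haggLabel s k = 3 q_k + r_k`, `r_k ∈ {0, 1, 2}`.
The fibre with index `f = (I, J) ∈ ℤ²` collects the sites `barlowPosH a H s k (I − q_k) (J − q_k)`,
`k ∈ ℤ`, whose in-plane position is `I u + J v + r_k w`, within `|2 w| = 2a/√3 ≤ 6/5` of the fibre
axis `I u + J v` (`FibreDecomposition.dist_site_axis_le`); for fixed `k` the index map is a
translation, hence injective.  With `E_f` the squared in-plane distance from the axis to `c` and
`T_f = √((L − 6/5)² − E_f)`, the layer interval of `f` is `{k : |H k − c₂| ≤ T_f}` — an integer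
interval `[M₁ f, M₂ f]` because `H` is strictly increasing and unbounded in both directions
(`FibreDecomposition.exists_firstLayer/lastLayer`); its sites lie in the ball by the triangle
inequality through the axis point at height `H k`.  `F` = the indices with `E_f ≤ (L − 6/5)²`; they
lie in a square box of side `2 (⌈5L/4⌉ + 1) + 1 ≤ 5 (L + 1)` around the lattice point nearest to the
in-plane projection of `c` (`FibreDecomposition.fibre_box`).  A ball point not covered has its axis
point at distance `> L − 6/5` from `c`, hence itself lies at distance `> L − 12/5 > L − 5`.  For
`L < 5` one takes `F = ∅`.  All [folklore] (elementary lattice geometry).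
-/

noncomputable section

namespace Summit.AtomisticToContinuum.Crystallization.Theorems.HcpLandscapeGapBirth

open Literature.MathematicalPhysics.StatisticalMechanics

namespace FibreDecomposition

/-- Coordinates of the axis point `I u + J v + t e₃`. [folklore] -/
theorem axis_apply (a t : ℝ) (I J : ℤ) :
    ((I : ℝ) • triangularVec₁ a + (J : ℝ) • triangularVec₂ a + layerNormal t) 0 = a * (I + J / 2) ∧
    ((I : ℝ) • triangularVec₁ a + (J : ℝ) • triangularVec₂ a + layerNormal t) 1 = a * √3 / 2 * J ∧
    ((I : ℝ) • triangularVec₁ a + (J : ℝ) • triangularVec₂ a + layerNormal t) 2 = t := by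
  refine ⟨?_, ?_, ?_⟩ <;> simp [triangularVec₁, triangularVec₂, layerNormal] <;> ring

/-- **A fibre site is within `6/5` of its axis.**  If `haggLabel s k = 3 q + r` with
`r ∈ {0, 1, 2}` and `0 ≤ a ≤ 1`, the site `barlowPosH a H s k (I − q) (J − q)` (in-plane position
`I u + J v + r w`) is at distance `a r/√3 ≤ 6/5` from the axis point `I u + J v + (H k) e₃`.
[folklore] -/
theorem dist_site_axis_le {a : ℝ} (ha0 : 0 ≤ a) (ha1 : a ≤ 1) (H : ℤ → ℝ) (s : ℤ → ℤ)
    {k q r : ℤ} (hL : haggLabel s k = 3 * q + r) (hr0 : 0 ≤ r) (hr2 : r ≤ 2) (I J : ℤ) :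
    dist (barlowPosH a H s k (I - q) (J - q))
      ((I : ℝ) • triangularVec₁ a + (J : ℝ) • triangularVec₂ a + layerNormal (H k)) ≤ 6 / 5 := by
  have h33 : (√3 : ℝ) ^ 2 = 3 := Real.sq_sqrt (by norm_num)
  obtain ⟨e0, e1, e2⟩ := axis_apply a (H k) I J
  have hsq : dist (barlowPosH a H s k (I - q) (J - q))
      ((I : ℝ) • triangularVec₁ a + (J : ℝ) • triangularVec₂ a + layerNormal (H k)) ^ 2 =
        a ^ 2 * (r : ℝ) ^ 2 / 3 := by
    rw [EuclideanSpace.dist_sq_eq, Fin.sum_univ_three, Real.dist_eq, Real.dist_eq, Real.dist_eq,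
      sq_abs, sq_abs, sq_abs, barlowPosH_apply_zero, barlowPosH_apply_one, barlowPosH_apply_two,
      hL, e0, e1, e2]
    push_cast
    linear_combination (a ^ 2 * (r : ℝ) ^ 2 / 36) * h33
  have hr0' : (0 : ℝ) ≤ r := by exact_mod_cast hr0
  have hr2' : (r : ℝ) ≤ 2 := by exact_mod_cast hr2
  have har0 : 0 ≤ a * r := mul_nonneg ha0 hr0'
  have har2 : a * r ≤ 2 := by nlinarith
  have hb : dist (barlowPosH a H s k (I - q) (J - q))
      ((I : ℝ) • triangularVec₁ a + (J : ℝ) • triangularVec₂ a + layerNormal (H k)) ^ 2 ≤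
        (6 / 5) ^ 2 := by
    rw [hsq]; nlinarith
  exact (pow_le_pow_iff_left₀ dist_nonneg (by norm_num) two_ne_zero).1 hb

/-- **Distance from the axis point to the centre**: for the axis point `Y = I u + J v + t e₃`,
`dist(Y, c)² = (a (I + J/2) − c₀)² + (a √3/2 · J − c₁)² + (t − c₂)²`. [folklore] -/
theorem dist_axis_sq (a t : ℝ) (I J : ℤ) (c : EuclideanSpace ℝ (Fin 3)) :
    dist ((I : ℝ) • triangularVec₁ a + (J : ℝ) • triangularVec₂ a + layerNormal t) c ^ 2 =
      (a * (I + J / 2) - c 0) ^ 2 + (a * √3 / 2 * J - c 1) ^ 2 + (t - c 2) ^ 2 := by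
  obtain ⟨e0, e1, e2⟩ := axis_apply a t I J
  rw [EuclideanSpace.dist_sq_eq, Fin.sum_univ_three, Real.dist_eq, Real.dist_eq, Real.dist_eq,
    sq_abs, sq_abs, sq_abs, e0, e1, e2]

/-- **The fibre indices near the centre lie in a box.**  For `a ∈ [47/50, 1]` there is a lattice
point `(I₀, J₀)` (the integer parts of the `(u, v)`-coordinates of `(c₀, c₁)`) such that every
`(I, J)` whose axis is within in-plane distance `L` of `(c₀, c₁)` satisfies
`|I − I₀|, |J − J₀| ≤ N` whenever `N ≥ 5L/4 + 1` (the form `x² + xy + y²` dominates `¾ x²` and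
`¾ y²`, and `(4/3) (50/47)² ≤ (5/4)²`). [folklore] -/
theorem fibre_box {a : ℝ} (ha1 : 47 / 50 ≤ a) (c₀ c₁ : ℝ) {L : ℝ} (hL : 0 ≤ L)
    {N : ℤ} (hN : 5 / 4 * L + 1 ≤ (N : ℝ)) :
    ∃ I₀ J₀ : ℤ, ∀ I J : ℤ,
      (a * (I + J / 2) - c₀) ^ 2 + (a * √3 / 2 * J - c₁) ^ 2 ≤ L ^ 2 →
        I₀ - N ≤ I ∧ I ≤ I₀ + N ∧ J₀ - N ≤ J ∧ J ≤ J₀ + N := by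
  have ha0 : 0 < a := by linarith
  have h3 : (0 : ℝ) < √3 := Real.sqrt_pos.2 (by norm_num)
  have h33 : (√3 : ℝ) ^ 2 = 3 := Real.sq_sqrt (by norm_num)
  set β : ℝ := 2 * c₁ / (a * √3) with hβ
  set α : ℝ := c₀ / a - β / 2 with hα
  have hc₀ : c₀ = a * (α + β / 2) := by rw [hα]; field_simp; ring
  have hc₁ : c₁ = a * √3 / 2 * β := by
    rw [hβ]; field_simp
  refine ⟨⌊α⌋, ⌊β⌋, fun I J hE => ?_⟩
  have hEq : (a * (I + J / 2) - c₀) ^ 2 + (a * √3 / 2 * J - c₁) ^ 2 =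
      a ^ 2 * (((I : ℝ) - α) ^ 2 + ((I : ℝ) - α) * ((J : ℝ) - β) + ((J : ℝ) - β) ^ 2) := by
    rw [hc₀, hc₁]; linear_combination (a ^ 2 * ((J : ℝ) - β) ^ 2 / 4) * h33
  rw [hEq] at hE
  have haa : (47 / 50 : ℝ) ^ 2 ≤ a ^ 2 := pow_le_pow_left₀ (by norm_num) ha1 2
  have hx2 : 3 / 4 * a ^ 2 * ((I : ℝ) - α) ^ 2 ≤ L ^ 2 := by
    nlinarith [sq_nonneg (((I : ℝ) - α) / 2 + ((J : ℝ) - β)), sq_nonneg a]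
  have hy2 : 3 / 4 * a ^ 2 * ((J : ℝ) - β) ^ 2 ≤ L ^ 2 := by
    nlinarith [sq_nonneg (((I : ℝ) - α) + ((J : ℝ) - β) / 2), sq_nonneg a]
  have hx3 : ((I : ℝ) - α) ^ 2 ≤ (5 / 4 * L) ^ 2 := by
    nlinarith [sq_nonneg ((I : ℝ) - α)]
  have hy3 : ((J : ℝ) - β) ^ 2 ≤ (5 / 4 * L) ^ 2 := by
    nlinarith [sq_nonneg ((J : ℝ) - β)]
  obtain ⟨hx4, hx5⟩ := abs_le_of_sq_le_sq' hx3 (by positivity)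
  obtain ⟨hy4, hy5⟩ := abs_le_of_sq_le_sq' hy3 (by positivity)
  have hfα := Int.floor_le α
  have hfα' := Int.lt_floor_add_one α
  have hfβ := Int.floor_le β
  have hfβ' := Int.lt_floor_add_one β
  refine ⟨?_, ?_, ?_, ?_⟩
  · have : ((⌊α⌋ - N : ℤ) : ℝ) ≤ I := by push_cast; linarith
    exact_mod_cast this
  · have : (I : ℝ) ≤ ((⌊α⌋ + N : ℤ) : ℝ) := by push_cast; linarith
    exact_mod_cast this
  · have : ((⌊β⌋ - N : ℤ) : ℝ) ≤ J := by push_cast; linarith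
    exact_mod_cast this
  · have : (J : ℝ) ≤ ((⌊β⌋ + N : ℤ) : ℝ) := by push_cast; linarith
    exact_mod_cast this

/-- **First layer above a level.**  For heights with gaps `≥ g > 0` there is `M : ℝ → ℤ` with
`M t ≤ k ↔ t ≤ H k`: `M t` is the least layer at height `≥ t` (it exists since `H` is strictly
increasing and unbounded above and below, `sub_le_of_gap_le`). [folklore] -/
theorem exists_firstLayer {H : ℤ → ℝ} {g : ℝ} (hg : 0 < g) (hgap : ∀ k : ℤ, g ≤ H (k + 1) - H k) :
    ∃ M : ℝ → ℤ, ∀ (t : ℝ) (k : ℤ), M t ≤ k ↔ t ≤ H k := by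
  have hmono : StrictMono H := strictMono_int_of_lt_succ fun n => by linarith [hgap n]
  have hup : ∀ t : ℝ, ∃ k : ℤ, t ≤ H k := by
    intro t
    obtain ⟨n, hn⟩ := exists_nat_ge ((t - H 0) / g)
    refine ⟨n, ?_⟩
    have h1 := sub_le_of_gap_le H hgap (show (0 : ℤ) ≤ n by positivity)
    have h2 : t - H 0 ≤ n * g := by rwa [div_le_iff₀ hg] at hn
    push_cast at h1
    nlinarith
  have hdown : ∀ t : ℝ, ∃ k : ℤ, H k ≤ t := by
    intro t
    obtain ⟨n, hn⟩ := exists_nat_ge ((H 0 - t) / g)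
    refine ⟨-n, ?_⟩
    have h1 := sub_le_of_gap_le H hgap (show -(n : ℤ) ≤ 0 by omega)
    have h2 : H 0 - t ≤ n * g := by rwa [div_le_iff₀ hg] at hn
    push_cast at h1
    nlinarith
  refine ⟨fun t => sInf {k : ℤ | t ≤ H k}, fun t k => ?_⟩
  have hne : {k : ℤ | t ≤ H k}.Nonempty := hup t
  have hbdd : BddBelow {k : ℤ | t ≤ H k} := by
    obtain ⟨k₀, hk₀⟩ := hdown (t - 1)
    refine ⟨k₀, fun k hk => le_of_not_gt fun hlt => ?_⟩
    simp only [Set.mem_setOf_eq] at hk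
    have := hmono hlt
    linarith
  constructor
  · intro hle
    have hmem : t ≤ H (sInf {k : ℤ | t ≤ H k}) := Int.csInf_mem hne hbdd
    exact hmem.trans (hmono.monotone hle)
  · intro hk
    exact csInf_le hbdd hk

/-- **Last layer below a level.**  For heights with gaps `≥ g > 0` there is `M : ℝ → ℤ` with
`k ≤ M t ↔ H k ≤ t`: `M t` is the greatest layer at height `≤ t`. [folklore] -/
theorem exists_lastLayer {H : ℤ → ℝ} {g : ℝ} (hg : 0 < g) (hgap : ∀ k : ℤ, g ≤ H (k + 1) - H k) :
    ∃ M : ℝ → ℤ, ∀ (t : ℝ) (k : ℤ), k ≤ M t ↔ H k ≤ t := by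
  have hmono : StrictMono H := strictMono_int_of_lt_succ fun n => by linarith [hgap n]
  have hup : ∀ t : ℝ, ∃ k : ℤ, t ≤ H k := by
    intro t
    obtain ⟨n, hn⟩ := exists_nat_ge ((t - H 0) / g)
    refine ⟨n, ?_⟩
    have h1 := sub_le_of_gap_le H hgap (show (0 : ℤ) ≤ n by positivity)
    have h2 : t - H 0 ≤ n * g := by rwa [div_le_iff₀ hg] at hn
    push_cast at h1
    nlinarith
  have hdown : ∀ t : ℝ, ∃ k : ℤ, H k ≤ t := by
    intro t
    obtain ⟨n, hn⟩ := exists_nat_ge ((H 0 - t) / g)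
    refine ⟨-n, ?_⟩
    have h1 := sub_le_of_gap_le H hgap (show -(n : ℤ) ≤ 0 by omega)
    have h2 : H 0 - t ≤ n * g := by rwa [div_le_iff₀ hg] at hn
    push_cast at h1
    nlinarith
  refine ⟨fun t => sSup {k : ℤ | H k ≤ t}, fun t k => ?_⟩
  have hne : {k : ℤ | H k ≤ t}.Nonempty := hdown t
  have hbdd : BddAbove {k : ℤ | H k ≤ t} := by
    obtain ⟨k₀, hk₀⟩ := hup (t + 1)
    refine ⟨k₀, fun k hk => le_of_not_gt fun hlt => ?_⟩
    simp only [Set.mem_setOf_eq] at hk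
    have := hmono hlt
    linarith
  constructor
  · intro hle
    have hmem : H (sSup {k : ℤ | H k ≤ t}) ≤ t := Int.csSup_mem hne hbdd
    exact (hmono.monotone hle).trans hmem
  · intro hk
    exact le_csSup hbdd hk

end FibreDecomposition

open FibreDecomposition in
/-- **Stub RF — fibre decomposition of a ball window of a Barlow multilattice.**  There is an
absolute `C` (`= 25`) such that for `a ∈ [47/50, 1]`, a Hägg word `s`, heights `H` with spacings in
`[39a/50, 17a/20]`, every centre `c` and radius `L ≥ 0` there are: a finite set `F` of fibre
indices with `#F ≤ C (L+1)²`, layer intervals `[M₁ f, M₂ f]` (possibly empty) and in-layer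
indices `ι f k` (injective in `f` for each layer `k`) such that every fibre site
`barlowPosH a H s k (ι f k)` with `k ∈ [M₁ f, M₂ f]`, `f ∈ F`, lies in the closed ball
`dist · c ≤ L`, and every multilattice point of that ball not so covered lies at depth `< 5`:
`L − 5 < dist · c`.  Construction: `ι (I, J) k = (I − q_k, J − q_k)` with
`haggLabel s k = 3 q_k + r_k`, `r_k ∈ {0,1,2}`; `[M₁ f, M₂ f] = {k : |H k − c₂| ≤ T_f}`,
`T_f = √((L − 6/5)² − E_f)`, `E_f` the squared in-plane distance of the axis `I u + J v` to `c`;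
`F = {f : E_f ≤ (L − 6/5)²}` inside a box of side `≤ 5 (L+1)`; `F = ∅` if `L < 5`. [folklore] -/
theorem stub_fibreDecomposition : ∃ C : ℝ, ∀ (a : ℝ), 47 / 50 ≤ a → a ≤ 1 → ∀ s : ℤ → ℤ, Literature.MathematicalPhysics.StatisticalMechanics.IsHaggSeq s → ∀ H : ℤ → ℝ, (∀ k : ℤ, 39 / 50 * a ≤ H (k + 1) - H k ∧ H (k + 1) - H k ≤ 17 / 20 * a) → ∀ (c : EuclideanSpace ℝ (Fin 3)) (L : ℝ), 0 ≤ L → ∃ (F : Finset (ℤ × ℤ)) (M₁ M₂ : ℤ × ℤ → ℤ) (ι : ℤ × ℤ → ℤ → ℤ × ℤ), (F.card : ℝ) ≤ C * (L + 1) ^ 2 ∧ (∀ k : ℤ, Function.Injective (fun f : ℤ × ℤ => ι f k)) ∧ (∀ f ∈ F, ∀ k : ℤ, M₁ f ≤ k → k ≤ M₂ f → dist (Literature.MathematicalPhysics.StatisticalMechanics.barlowPosH a H s k (ι f k).1 (ι f k).2) c ≤ L) ∧ (∀ k i j : ℤ, dist (Literature.MathematicalPhysics.StatisticalMechanics.barlowPosH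 a H s k i j) c ≤ L → (∃ f ∈ F, M₁ f ≤ k ∧ k ≤ M₂ f ∧ ι f k = (i, j)) ∨ L - 5 < dist (Literature.MathematicalPhysics.StatisticalMechanics.barlowPosH a H s k i j) c) := by
  refine ⟨25, fun a ha1 ha2 s _hs H hH c L hL => ?_⟩
  rcases lt_or_ge L 5 with hL5 | hL5
  · -- small balls: everything is within depth `5`
    refine ⟨∅, fun _ => 0, fun _ => 0, fun f _ => f, ?_, fun k => Function.injective_id, ?_, ?_⟩
    · simp only [Finset.card_empty, Nat.cast_zero]; positivity
    · simp
    · intro k i j _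
      exact Or.inr (by linarith [dist_nonneg (x := barlowPosH a H s k i j) (y := c)])
  -- main case `5 ≤ L`
  have ha0 : 0 < a := by linarith
  have hgap : ∀ k : ℤ, 39 / 50 * a ≤ H (k + 1) - H k := fun k => (hH k).1
  obtain ⟨P, hP⟩ := exists_firstLayer (H := H) (by positivity : (0 : ℝ) < 39 / 50 * a) hgap
  obtain ⟨Q, hQ⟩ := exists_lastLayer (H := H) (by positivity : (0 : ℝ) < 39 / 50 * a) hgap
  -- letters `haggLabel s k = 3 q_k + r_k`
  obtain ⟨q, hq⟩ : ∃ q : ℤ → ℤ, ∀ k, q k = haggLabel s k / 3 := ⟨_, fun _ => rfl⟩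
  obtain ⟨r, hr⟩ : ∃ r : ℤ → ℤ, ∀ k, r k = haggLabel s k % 3 := ⟨_, fun _ => rfl⟩
  have hqr : ∀ k, haggLabel s k = 3 * q k + r k := fun k => by
    rw [hq, hr]; exact (Int.mul_ediv_add_emod _ _).symm
  have hr0 : ∀ k, 0 ≤ r k := fun k => by rw [hr]; exact Int.emod_nonneg _ (by norm_num)
  have hr2 : ∀ k, r k ≤ 2 := fun k => by
    have := Int.emod_lt_of_pos (haggLabel s k) (show (0 : ℤ) < 3 by norm_num)
    rw [hr]; omega
  -- the box of fibre indices
  set N : ℤ := ⌈5 / 4 * L⌉ + 1 with hN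
  have hN1 : 5 / 4 * L + 1 ≤ (N : ℝ) := by
    rw [hN]; push_cast; linarith [Int.le_ceil (5 / 4 * L)]
  have hN2 : (N : ℝ) < 5 / 4 * L + 2 := by
    rw [hN]; push_cast; linarith [Int.ceil_lt_add_one (5 / 4 * L)]
  have hN0 : 0 ≤ N := by
    have : (0 : ℝ) ≤ N := by linarith
    exact_mod_cast this
  obtain ⟨I₀, J₀, hbox⟩ := fibre_box ha1 (c 0) (c 1) hL hN1
  -- squared in-plane offset of the axis and the half-height of the layer interval
  obtain ⟨E, hE⟩ : ∃ E : ℤ × ℤ → ℝ, ∀ f, E f =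
      (a * (f.1 + f.2 / 2) - c 0) ^ 2 + (a * √3 / 2 * f.2 - c 1) ^ 2 := ⟨_, fun _ => rfl⟩
  obtain ⟨T, hT⟩ : ∃ T : ℤ × ℤ → ℝ, ∀ f, T f = √((L - 6 / 5) ^ 2 - E f) := ⟨_, fun _ => rfl⟩
  have hT0 : ∀ f, 0 ≤ T f := fun f => by rw [hT]; exact Real.sqrt_nonneg _
  -- geometry of the fibre sites: axis point `Y f k = f.1 u + f.2 v + (H k) e₃`
  have hXY : ∀ (f : ℤ × ℤ) (k : ℤ), dist (barlowPosH a H s k (f.1 - q k) (f.2 - q k))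
      ((f.1 : ℝ) • triangularVec₁ a + (f.2 : ℝ) • triangularVec₂ a + layerNormal (H k)) ≤ 6 / 5 :=
    fun f k => dist_site_axis_le ha0.le ha2 H s (hqr k) (hr0 k) (hr2 k) f.1 f.2
  have hYc : ∀ (f : ℤ × ℤ) (k : ℤ),
      dist ((f.1 : ℝ) • triangularVec₁ a + (f.2 : ℝ) • triangularVec₂ a + layerNormal (H k)) c ^ 2 =
        E f + (H k - c 2) ^ 2 := fun f k => by
    rw [dist_axis_sq, hE]
  refine ⟨(Finset.Icc (I₀ - N) (I₀ + N) ×ˢ Finset.Icc (J₀ - N) (J₀ + N)).filter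
      (fun f => E f ≤ (L - 6 / 5) ^ 2),
    fun f => P (c 2 - T f), fun f => Q (c 2 + T f), fun f k => (f.1 - q k, f.2 - q k),
    ?_, ?_, ?_, ?_⟩
  · -- `#F ≤ (2N+1)² ≤ 25 (L+1)²`
    have hIcc : ∀ m : ℤ, ((Finset.Icc (m - N) (m + N)).card : ℝ) = 2 * N + 1 := by
      intro m
      rw [Int.card_Icc, show m + N + 1 - (m - N) = 2 * N + 1 by ring, ← Int.cast_natCast,
        Int.toNat_of_nonneg (by omega)]
      push_cast; ring
    calc (((Finset.Icc (I₀ - N) (I₀ + N) ×ˢ Finset.Icc (J₀ - N) (J₀ + N)).filter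
          (fun f => E f ≤ (L - 6 / 5) ^ 2)).card : ℝ)
        ≤ ((Finset.Icc (I₀ - N) (I₀ + N) ×ˢ Finset.Icc (J₀ - N) (J₀ + N)).card : ℝ) := by
          exact_mod_cast Finset.card_filter_le _ _
      _ = (2 * N + 1) * (2 * N + 1) := by rw [Finset.card_product, Nat.cast_mul, hIcc, hIcc]
      _ ≤ 25 * (L + 1) ^ 2 := by
          have h0 : (0 : ℝ) ≤ N := by exact_mod_cast hN0
          have h1 : (2 * N + 1 : ℝ) ≤ 5 * (L + 1) := by linarith
          nlinarith
  · -- injectivity in `f` for fixed `k`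
    intro k f g hfg
    simp only [Prod.mk.injEq, sub_left_inj] at hfg
    exact Prod.ext hfg.1 hfg.2
  · -- fibre sites of `F` over `[M₁ f, M₂ f]` lie in the ball
    intro f hf k hk1 hk2
    rw [Finset.mem_filter] at hf
    have hEf : E f ≤ (L - 6 / 5) ^ 2 := hf.2
    have h1 : c 2 - T f ≤ H k := (hP _ k).1 hk1
    have h2 : H k ≤ c 2 + T f := (hQ _ k).1 hk2
    have hT2 : T f ^ 2 = (L - 6 / 5) ^ 2 - E f := by
      rw [hT]; exact Real.sq_sqrt (by linarith)
    have h3 : (H k - c 2) ^ 2 ≤ T f ^ 2 := sq_le_sq' (by linarith) (by linarith)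
    have h4 : dist ((f.1 : ℝ) • triangularVec₁ a + (f.2 : ℝ) • triangularVec₂ a +
        layerNormal (H k)) c ≤ L - 6 / 5 := by
      refine (pow_le_pow_iff_left₀ dist_nonneg (by linarith) two_ne_zero).1 ?_
      rw [hYc]; linarith
    show dist (barlowPosH a H s k (f.1 - q k) (f.2 - q k)) c ≤ L
    linarith [dist_triangle (barlowPosH a H s k (f.1 - q k) (f.2 - q k))
      ((f.1 : ℝ) • triangularVec₁ a + (f.2 : ℝ) • triangularVec₂ a + layerNormal (H k)) c, hXY f k]
  · -- a ball point is covered or within depth `12/5 < 5`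
    intro k i j hdist
    have hXY' := hXY (i + q k, j + q k) k
    have hYc' := hYc (i + q k, j + q k) k
    simp only [add_sub_cancel_right] at hXY'
    by_cases hY : dist ((((i + q k : ℤ) : ℝ)) • triangularVec₁ a + (((j + q k : ℤ) : ℝ)) •
        triangularVec₂ a + layerNormal (H k)) c ≤ L - 6 / 5
    · -- covered by the fibre `f = (i + q_k, j + q_k)`
      left
      have hsq : E (i + q k, j + q k) + (H k - c 2) ^ 2 ≤ (L - 6 / 5) ^ 2 := by
        rw [← hYc']; exact pow_le_pow_left₀ dist_nonneg hY 2
      have hEf : E (i + q k, j + q k) ≤ (L - 6 / 5) ^ 2 := by nlinarith [sq_nonneg (H k - c 2)]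
      have habs : |H k - c 2| ≤ T (i + q k, j + q k) := by
        rw [hT]; exact Real.abs_le_sqrt (by linarith)
      obtain ⟨hlo, hhi⟩ := abs_le.1 habs
      have hEL : E (i + q k, j + q k) ≤ L ^ 2 := by nlinarith
      have hb := hbox (i + q k) (j + q k) (by rw [hE] at hEL; exact_mod_cast hEL)
      refine ⟨(i + q k, j + q k), ?_, (hP _ k).2 (by linarith), (hQ _ k).2 (by linarith), ?_⟩
      · rw [Finset.mem_filter, Finset.mem_product, Finset.mem_Icc, Finset.mem_Icc]
        exact ⟨⟨⟨hb.1, hb.2.1⟩, hb.2.2.1, hb.2.2.2⟩, hEf⟩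
      · simp
    · -- not covered: the axis point is far, hence so is the site
      right
      push Not at hY
      linarith [dist_triangle ((((i + q k : ℤ) : ℝ)) • triangularVec₁ a + (((j + q k : ℤ) : ℝ)) •
        triangularVec₂ a + layerNormal (H k)) (barlowPosH a H s k i j) c,
        dist_comm ((((i + q k : ℤ) : ℝ)) • triangularVec₁ a + (((j + q k : ℤ) : ℝ)) •
        triangularVec₂ a + layerNormal (H k)) (barlowPosH a H s k i j)]

end Summit.AtomisticToContinuum.Crystallization.Theorems.HcpLandscapeGapBirth

end
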